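import Literature.MathematicalPhysics.QuantumFieldTheory.Balaban1983to89.Node00.Record12Measurability
import Literature.MathematicalPhysics.QuantumFieldTheory.Balaban1983to89.Node00.Record12Numerics
import Literature.MathematicalPhysics.QuantumFieldTheory.Balaban1983to89.Node00.Record12Residuals

/-!
# NODE 00 — K0′ COMPONENTS G3, FILE 3: rows P1 `intPiece`, P2 `measω`, P3 `measChi` AT THE PARAMETER OF RECORD
# `θ₀ = theta12OfRecord F N (zeta316OfRecord …) Rz Zt` — all three from the ONE clause `LocalBgMeasurable F N numerics7OfRecord₁₂`

Cell `pub-ymgap`, NODE 00, prover seat `pub-ymgap-node00-def-K0c` (g0); K0′ = `stmt-QuantumFields-19789` `Record12Inhabited` (rev 13∕15).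
[III] = [Balaban1988Convergent], [IV] = [Balaban1989LargeFieldI].

WHAT THIS FILE IS.  FILE 1 (`Node00/Record12Measurability`, p464234) reduced the three fields `intPiece` ∕ `measω` ∕ `measChi` of `Provisos₁₂.base =
θ.toStage9Params.Provisos₁₀` at ANY Stage-9 parameter with the identity selector to (H-U) `LocalBgMeasurable F N θ.ν` ∧ (H-ζ) `ZetaMeasurable θ.ζ` ∧ the
ζ-size law.  K0a's `Node00/Record12Numerics` (p464014) fixed the parameter of record `theta12OfRecord F N ζ Rz Zt` (numerics `numerics7OfRecord₁₂`, `τ9.M = 1`,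
`A₁ = 1`, identity selector — all `rfl`), and K0b's `Node00/Record12Residuals` (p465269) fixed the fluctuation factor OF PRINT `zeta316OfRecord F N ν M A₁` ((3.16)
at the one-cube backgrounds) with `isZetaAbsLeOne_zeta316OfRecord` PROVED and `measurable_zeta316OfRecord` FROM the measurability of the (3.3) small-fluctuation
events — which is FILE 1's `measurableSet_smallApproxFluct_of_localBg` under (H-U).  Hence, BY NAME:
* `zetaMeasurable_zeta316OfRecord_of_localBg` — (H-ζ) for K0b's ζ is a THEOREM under (H-U) (every `ν, M, A₁`); `zeta316OfRecord_nonneg` is K0b's;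
* **`measChi_theta12OfRecord`**, **`measω_theta12OfRecord`**, **`intPiece_theta12OfRecord`** — the three fields of `(theta12OfRecord F N (zeta316OfRecord F N
  numerics7OfRecord₁₂ 1 1) Rz Zt).toStage9Params.Provisos₁₀`, VERBATIM (up to the `rfl` views `θ₀.ν = numerics7OfRecord₁₂`, `θ₀.τ9.M = 1`, `θ₀.A₁ = 1`), for EVERY
  residual `Rz`, `Zt` (the rows do not read them), from the SINGLE hypothesis `hU : LocalBgMeasurable F N numerics7OfRecord₁₂`.
* (v1.1, §3) THE ASSEMBLY: `Stage12Params.provisos₁₀_of_localBg_of_residuals` ∕ `provisos₁₂_of_localBg_of_residuals` ∕ `record12Inhabited_body_of` — at a Stage-12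
  parameter with K0b's residuals of record and the identity selector, `base`, `Provisos₁₂` and K0′'s rev-13 body `∃ θ, Provisos₁₂ ∧ ZtUnity ∧ Admissible` follow from (H-U) and
  the rows P6 `rstep` (def-R), P7 `contT` (K0e), P11 `bg` taken as displayed HYPOTHESES; `record12Inhabited_body_theta12OfRecord_of` reads them AT `θ₀`.
* (v1.2, §4) the same for K0′'s rev-15 text `∃ θ, Provisos₁₂ ∧ (ZtUnity ∧ SlotsNondegenerate) ∧ Admissible` with row P12 `SlotsNondegenerate` (K0b) as one more
  displayed HYPOTHESIS: `Stage12Params.record12Inhabited_body15_of`, `record12Inhabited_body15_theta12OfRecord_of`.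
NET for the K0′ skeleton: at the θ of record rows P1 ∧ P2 ∧ P3 close MODULO ONE NAMED CLAUSE — the measurability of def-R's (2.16) local backgrounds over the
TOTALISED (2.12) solution map at the numerics of record — LOCATED-OPEN on the definition side at `N ≥ 2` (dag-n23-b's census (R-b); FILE 1's
`localBgMeasurable_of_measurable_Umin` is the hook for a re-pointed `UminOfRecord`).

HONEST FRAMING — what this is NOT.  Instantiation by name of FILE 1 at K0a's ∕ K0b's objects; `hU` is a DISPLAYED HYPOTHESIS, neither asserted nor discharged;
nothing of Bałaban's is asserted; no field of `Provisos₁₂` is inhabited at `N ≥ 2`; K0′ is NOT discharged; no node count moves (typed 28∕28 · discharged 5∕28).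
One finite four-torus programme at fixed `ε = L^{−K}` — NOT the continuum limit on ℝ⁴, NOT infinite volume, NOT OS, NOT a mass gap, NOT the Clay problem.
-/

noncomputable section

open MeasureTheory
open scoped Matrix.Norms.L2Operator

namespace Literature.MathematicalPhysics.QuantumFieldTheory.Balaban1983to89.Node00

open T4Continuum B14.Eq218Concrete T4AveragingDisintegration T4FiniteEpsInhabited B14.Sect3Decomp

variable (F : T4Family) (N : ℕ) [NeZero N]

/-! ## §1. (H-ζ) for K0b's fluctuation factor of print is a theorem under (H-U) -/

variable {F N} in
/-- **(H-ζ) FOR THE ζ OF RECORD FROM (H-U)**: K0b's `zeta316OfRecord F N ν M A₁` — a product of indicators of the (3.3)∕(3.16) small-fluctuation events — is jointly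
measurable in `(V′, U)` as soon as def-R's local backgrounds are measurable (K0b's `measurable_zeta316OfRecord` at FILE 1's `measurableSet_smallApproxFluct_of_localBg`).
[cite: Balaban1988Convergent, (3.3) p.265, (3.16) p.268 (bookkeeping)] -/
theorem zetaMeasurable_zeta316OfRecord_of_localBg {ν : Stage7Numerics} (hU : LocalBgMeasurable F N ν) (M : ℕ) (A₁ : ℝ) :
    ZetaMeasurable F N (zeta316OfRecord F N ν M A₁) :=
  fun p g k s Pl Ql RS => measurable_zeta316OfRecord A₁ p g k s Pl Ql RS fun c => measurableSet_smallApproxFluct_of_localBg hU M p g k s _ c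

/-! ## §2. The three rows at `θ₀ = theta12OfRecord F N (zeta316OfRecord F N numerics7OfRecord₁₂ 1 1) Rz Zt` -/

section AtRecord

variable {F N} (hU : LocalBgMeasurable F N numerics7OfRecord₁₂)
include hU

/-- **ROW P3 AT θ₀** (any `ζ`, `Rz`, `Zt`): the front factors `χ_{k+1}(s′)` of record along the generated histories of `theta12OfRecord F N ζ Rz Zt` are measurable, `k < K` —
the field `base.measChi` of `Provisos₁₂` at `θ₀`, from `hU` alone. [cite: Balaban1988Convergent, (2.17)–(2.18) p.257, (3.2) p.265 (bookkeeping)] -/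
theorem measChi_theta12OfRecord (ζ : ZetaOfRecord F N numerics7OfRecord₁₂ 1) (Rz : (K : ℕ) → Sect2.Residual (F.P K) (MatA N))
    (Zt : (K : ℕ) → TkResidualW F N (FluctV N) K) :
    ∀ (p : B12.RunParams) (k : ℕ), k < p.K →
      ∀ s' : SeqOfRecord F numerics7OfRecord₁₂ 1 (gOfRecord₁₀ F N (theta12OfRecord F N ζ Rz Zt).toStage9Params p) p.K (k + 1),
        Measurable (chiSeqOfRecord F N numerics7OfRecord₁₂ 1 (gOfRecord₁₀ F N (theta12OfRecord F N ζ Rz Zt).toStage9Params p) p.K (k + 1) s') :=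
  (theta12OfRecord F N ζ Rz Zt).toStage9Params.measChi_of_localBg hU

/-- **ROW P2 AT θ₀** (any `Rz`, `Zt`): the label weights `ω = a·b·ζ` of record, at `A₁ = 1` and K0b's `ζ = zeta316OfRecord …`, are jointly measurable in `(V′, U)`, `k < K` —
the field `base.measω` of `Provisos₁₂` at `θ₀`, from `hU` alone ((H-ζ) by §1). [cite: Balaban1988Convergent, (3.2)–(3.5) p.265, (3.16) p.268, (3.24)–(3.25) p.270 (bookkeeping)] -/
theorem measω_theta12OfRecord (Rz : (K : ℕ) → Sect2.Residual (F.P K) (MatA N)) (Zt : (K : ℕ) → TkResidualW F N (FluctV N) K) :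
    ∀ (p : B12.RunParams) (k : ℕ), k < p.K →
      ∀ (s : SeqOfRecord F numerics7OfRecord₁₂ 1
          (gOfRecord₁₀ F N (theta12OfRecord F N (zeta316OfRecord F N numerics7OfRecord₁₂ 1 1) Rz Zt).toStage9Params p) p.K k)
        (t : LbOfRecord F numerics7OfRecord₁₂ p
          (gOfRecord₁₀ F N (theta12OfRecord F N (zeta316OfRecord F N numerics7OfRecord₁₂ 1 1) Rz Zt).toStage9Params p) k),
        Measurable (fun z : GaugeField (F.P p.K) (k + 1) (SU N) × GaugeField (F.P p.K) k (SU N) =>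
          ωOfRecord F N numerics7OfRecord₁₂ 1 p
            (gOfRecord₁₀ F N (theta12OfRecord F N (zeta316OfRecord F N numerics7OfRecord₁₂ 1 1) Rz Zt).toStage9Params p) k 1
            (zeta316OfRecord F N numerics7OfRecord₁₂ 1 1) s t z.2 z.1) :=
  (theta12OfRecord F N (zeta316OfRecord F N numerics7OfRecord₁₂ 1 1) Rz Zt).toStage9Params.measω_of_localBg hU
    (zetaMeasurable_zeta316OfRecord_of_localBg hU 1 1)

/-- **ROW P1 AT θ₀** (any `Rz`, `Zt`): the level-`k` pieces `χ_k(s)·slot_k(s)` of `ρ_k` of record along the generated histories of `θ₀` are integrable, `k < K` — the field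
`base.intPiece` of `Provisos₁₂` at `θ₀`, from `hU` alone (identity selector by `theta12OfRecord_ppSel`; the ζ-size law is K0b's `isZetaAbsLeOne_zeta316OfRecord`; NO bound
on the marginal density of the averaging transport). [cite: Balaban1988Convergent, (2.18) p.257, (3.24)–(3.25) p.270; Balaban1989LargeFieldI, (0.3)–(0.4) p.176 (bookkeeping)] -/
theorem intPiece_theta12OfRecord (Rz : (K : ℕ) → Sect2.Residual (F.P K) (MatA N)) (Zt : (K : ℕ) → TkResidualW F N (FluctV N) K) :
    ∀ (p : B12.RunParams) (k : ℕ), k < p.K →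
      ∀ s : SeqOfRecord F numerics7OfRecord₁₂ 1
          (gOfRecord₁₀ F N (theta12OfRecord F N (zeta316OfRecord F N numerics7OfRecord₁₂ 1 1) Rz Zt).toStage9Params p) p.K k,
        Integrable (fun U =>
          chiSeqOfRecord F N numerics7OfRecord₁₂ 1
              (gOfRecord₁₀ F N (theta12OfRecord F N (zeta316OfRecord F N numerics7OfRecord₁₂ 1 1) Rz Zt).toStage9Params p) p.K k s U *
            slotsOfRecord F N numerics7OfRecord₁₂ (theta12OfRecord F N (zeta316OfRecord F N numerics7OfRecord₁₂ 1 1) Rz Zt).τ9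
              (EOfRecord₁₀ F N (theta12OfRecord F N (zeta316OfRecord F N numerics7OfRecord₁₂ 1 1) Rz Zt).toStage9Params)
              (wOfRecord₉ F N (theta12OfRecord F N (zeta316OfRecord F N numerics7OfRecord₁₂ 1 1) Rz Zt).toStage9Params)
              (ppSelIdOfRecord F numerics7OfRecord₁₂ 1) p
              (gOfRecord₁₀ F N (theta12OfRecord F N (zeta316OfRecord F N numerics7OfRecord₁₂ 1 1) Rz Zt).toStage9Params p) k s U)
          (fieldMeasure (F.P p.K) k (SU N)) :=
  (theta12OfRecord F N (zeta316OfRecord F N numerics7OfRecord₁₂ 1 1) Rz Zt).toStage9Params.intPiece_of_localBg rfl hU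
    (zetaMeasurable_zeta316OfRecord_of_localBg hU 1 1) (isZetaAbsLeOne_zeta316OfRecord 1)

end AtRecord

/-! ## §3. (v1.1) THE PROVISOS ASSEMBLED MODULO THE NAMED OPEN ROWS: `Provisos₁₀` ∕ `Provisos₁₂` at a Stage-12 parameter carrying K0b's residuals of record
and the identity selector, from (H-U) + row P6 (def-R's `rstep`, hypothesis) + row P7 (K0e's `contT`, hypothesis) [+ row P11 `bg`, hypothesis]; K0′'s rev-13 body
`∃ θ, Provisos₁₂ ∧ ZtUnity ∧ Admissible` for the family `F`, every `N`, at `θ₀` from the same hypotheses (K0a's `admissible_theta12OfRecord`, K0b's `ztUnity`) -/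

section Assembly

variable {F N}

/-- **`base = Provisos₁₀` AT A STAGE-12 PARAMETER WITH THE RESIDUALS OF RECORD, MODULO ROWS (H-U), P6, P7**: rows P1∕P2∕P3 from (H-U) (FILE 1 §5; (H-ζ) by
`zetaMeasurable_zeta316OfRecord_of_localBg`), P4∕P5 from K0b's `HasResidualsOfRecord.zetaUnity ∕ .zetaAbs`; `rstep` (row P6, def-R) and `contT` (row P7, K0e:
LOCATED-OPEN over-strength) are HYPOTHESES, displayed verbatim. [cite: Balaban1988Convergent, (2.18) p.257, (3.2)–(3.9) pp.265–266, (3.16) p.268; Balaban1989LargeFieldI, (0.3)–(0.4) p.176 (bookkeeping)] -/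
theorem Stage12Params.provisos₁₀_of_localBg_of_residuals (θ : Stage12Params F N) (hsel : θ.ppSel = ppSelIdOfRecord F θ.ν θ.τ9.M)
    (hU : LocalBgMeasurable F N θ.ν) (hres : θ.HasResidualsOfRecord F N)
    (hrstep : ∀ (p : B12.RunParams) (k : ℕ) [DecidableEq (PBond (F.P p.K) (k + 1))], k < p.K →
      (towerRepOfRecord F N θ.ν θ.τ9 (slotsTOfRecord F N θ.ν θ.τ9 (EOfRecord₁₀ F N θ.toStage9Params) (wOfRecord₉ F N θ.toStage9Params) θ.ppSel)
        θ.ppSel p (gOfRecord₁₀ F N θ.toStage9Params p) (k + 1)).toRepData.ProvisosSupp)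
    (hcontT : θ.toStage8Params.HasContTransportAlong) : θ.toStage9Params.Provisos₁₀ where
  intPiece := θ.toStage9Params.intPiece_of_localBg hsel hU
    (by rw [hres.zeta_eq]; exact zetaMeasurable_zeta316OfRecord_of_localBg hU θ.τ9.M θ.A₁) hres.zetaAbs
  measω := θ.toStage9Params.measω_of_localBg hU (by rw [hres.zeta_eq]; exact zetaMeasurable_zeta316OfRecord_of_localBg hU θ.τ9.M θ.A₁)
  measChi := θ.toStage9Params.measChi_of_localBg hU
  zetaUnity := hres.zetaUnity
  zetaAbs := hres.zetaAbs
  rstep := fun p k _ hk => hrstep p k hk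
  contT := hcontT

/-- **`Provisos₁₂` AT SUCH A PARAMETER, MODULO ROWS (H-U), P6, P7, P11**: `base` as above; `rzLaws`, `ztLaws`, `ztLocal` are K0b's theorems; `bg` (row P11, the window-guarded
estimate of print) is a HYPOTHESIS, displayed verbatim. [cite: Balaban1988Convergent, (2.28) p.259, (2.35) p.261; Balaban1987RG1, (1.15) p.262 (bookkeeping)] -/
theorem Stage12Params.provisos₁₂_of_localBg_of_residuals (θ : Stage12Params F N) (hsel : θ.ppSel = ppSelIdOfRecord F θ.ν θ.τ9.M)
    (hU : LocalBgMeasurable F N θ.ν) (hres : θ.HasResidualsOfRecord F N)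
    (hrstep : ∀ (p : B12.RunParams) (k : ℕ) [DecidableEq (PBond (F.P p.K) (k + 1))], k < p.K →
      (towerRepOfRecord F N θ.ν θ.τ9 (slotsTOfRecord F N θ.ν θ.τ9 (EOfRecord₁₀ F N θ.toStage9Params) (wOfRecord₉ F N θ.toStage9Params) θ.ppSel)
        θ.ppSel p (gOfRecord₁₀ F N θ.toStage9Params p) (k + 1)).toRepData.ProvisosSupp)
    (hcontT : θ.toStage8Params.HasContTransportAlong)
    (hbg : ∀ (p : B12.RunParams) (n : ℕ), n ≤ p.K → Step.InInterval θ.γ n (gOfRecord₁₀ F N θ.toStage9Params p) →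
      BgProviso F N p.K (settingOfRecord₁₂ F N θ p) (θ.Rz p.K) θ.τ9.M n (suppOfRecord₁₂ F N θ p n) (UbgOfRecord₁₂ F N θ p n)) :
    θ.Provisos₁₂ F N :=
  ⟨θ.provisos₁₀_of_localBg_of_residuals hsel hU hres hrstep hcontT, hres.rzLaws, hres.ztLaws, hres.ztLocal, hbg⟩

/-- **K0′'s rev-13 BODY for the family `F` (every `N`), MODULO THE SAME ROWS, at any admissible such parameter**: `∃ θ, θ.Provisos₁₂ ∧ θ.ZtUnity ∧ θ.Admissible` (the text of
`stmt-QuantumFields-19789` at `N = 2`; a later restate adding `θ.SlotsNondegenerate` is K0b's row P12, not read here).  A REDUCTION — nothing is discharged.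
[cite: Balaban1988Convergent, Thm 1 p.262; Balaban1989LargeFieldII, Thm 1 p.355 (bookkeeping)] -/
theorem Stage12Params.record12Inhabited_body_of (θ : Stage12Params F N) (hsel : θ.ppSel = ppSelIdOfRecord F θ.ν θ.τ9.M)
    (hU : LocalBgMeasurable F N θ.ν) (hres : θ.HasResidualsOfRecord F N)
    (hrstep : ∀ (p : B12.RunParams) (k : ℕ) [DecidableEq (PBond (F.P p.K) (k + 1))], k < p.K →
      (towerRepOfRecord F N θ.ν θ.τ9 (slotsTOfRecord F N θ.ν θ.τ9 (EOfRecord₁₀ F N θ.toStage9Params) (wOfRecord₉ F N θ.toStage9Params) θ.ppSel)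
        θ.ppSel p (gOfRecord₁₀ F N θ.toStage9Params p) (k + 1)).toRepData.ProvisosSupp)
    (hcontT : θ.toStage8Params.HasContTransportAlong)
    (hbg : ∀ (p : B12.RunParams) (n : ℕ), n ≤ p.K → Step.InInterval θ.γ n (gOfRecord₁₀ F N θ.toStage9Params p) →
      BgProviso F N p.K (settingOfRecord₁₂ F N θ p) (θ.Rz p.K) θ.τ9.M n (suppOfRecord₁₂ F N θ p n) (UbgOfRecord₁₂ F N θ p n))
    (hadm : θ.Admissible F N) :
    ∃ θ' : Stage12Params F N, θ'.Provisos₁₂ F N ∧ θ'.ZtUnity F N ∧ θ'.Admissible F N :=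
  ⟨θ, θ.provisos₁₂_of_localBg_of_residuals hsel hU hres hrstep hcontT hbg, hres.ztUnity, hadm⟩

variable (F N) in
/-- **THE θ OF RECORD QUALIFIES**: `θ₀ = theta12OfRecord F N (zeta316OfRecord F N numerics7OfRecord₁₂ 1 1) (RzOfRecord F N) (ZtOfRecord F N)` has the identity selector (`rfl`),
the residuals of record (`⟨rfl, rfl, rfl⟩`, K0b's junction) and is admissible (K0a's `admissible_theta12OfRecord`) — so at `θ₀` K0′'s rev-13 body for `F` follows from
`LocalBgMeasurable F N numerics7OfRecord₁₂` and the rows P6, P7, P11 read AT `θ₀`. [cite: Balaban1988Convergent, Thm 1 p.262 (bookkeeping)] -/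
theorem record12Inhabited_body_theta12OfRecord_of (hU : LocalBgMeasurable F N numerics7OfRecord₁₂)
    (hrstep : ∀ (p : B12.RunParams) (k : ℕ) [DecidableEq (PBond (F.P p.K) (k + 1))], k < p.K →
      (towerRepOfRecord F N numerics7OfRecord₁₂
          (theta12OfRecord F N (zeta316OfRecord F N numerics7OfRecord₁₂ 1 1) (RzOfRecord F N) (ZtOfRecord F N)).τ9
          (slotsTOfRecord F N numerics7OfRecord₁₂
            (theta12OfRecord F N (zeta316OfRecord F N numerics7OfRecord₁₂ 1 1) (RzOfRecord F N) (ZtOfRecord F N)).τ9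
            (EOfRecord₁₀ F N (theta12OfRecord F N (zeta316OfRecord F N numerics7OfRecord₁₂ 1 1) (RzOfRecord F N) (ZtOfRecord F N)).toStage9Params)
            (wOfRecord₉ F N (theta12OfRecord F N (zeta316OfRecord F N numerics7OfRecord₁₂ 1 1) (RzOfRecord F N) (ZtOfRecord F N)).toStage9Params)
            (ppSelIdOfRecord F numerics7OfRecord₁₂ 1))
          (ppSelIdOfRecord F numerics7OfRecord₁₂ 1) p
          (gOfRecord₁₀ F N (theta12OfRecord F N (zeta316OfRecord F N numerics7OfRecord₁₂ 1 1) (RzOfRecord F N) (ZtOfRecord F N)).toStage9Params p)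
          (k + 1)).toRepData.ProvisosSupp)
    (hcontT : (theta12OfRecord F N (zeta316OfRecord F N numerics7OfRecord₁₂ 1 1) (RzOfRecord F N) (ZtOfRecord F N)).toStage8Params.HasContTransportAlong)
    (hbg : ∀ (p : B12.RunParams) (n : ℕ), n ≤ p.K →
      Step.InInterval (1 / 2 : ℝ) n
        (gOfRecord₁₀ F N (theta12OfRecord F N (zeta316OfRecord F N numerics7OfRecord₁₂ 1 1) (RzOfRecord F N) (ZtOfRecord F N)).toStage9Params p) →
      BgProviso F N p.K
        (settingOfRecord₁₂ F N (theta12OfRecord F N (zeta316OfRecord F N numerics7OfRecord₁₂ 1 1) (RzOfRecord F N) (ZtOfRecord F N)) p)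
        (RzOfRecord F N p.K) 1 n
        (suppOfRecord₁₂ F N (theta12OfRecord F N (zeta316OfRecord F N numerics7OfRecord₁₂ 1 1) (RzOfRecord F N) (ZtOfRecord F N)) p n)
        (UbgOfRecord₁₂ F N (theta12OfRecord F N (zeta316OfRecord F N numerics7OfRecord₁₂ 1 1) (RzOfRecord F N) (ZtOfRecord F N)) p n)) :
    ∃ θ : Stage12Params F N, θ.Provisos₁₂ F N ∧ θ.ZtUnity F N ∧ θ.Admissible F N :=
  (theta12OfRecord F N (zeta316OfRecord F N numerics7OfRecord₁₂ 1 1) (RzOfRecord F N) (ZtOfRecord F N)).record12Inhabited_body_of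
    rfl hU ⟨rfl, rfl, rfl⟩ hrstep hcontT hbg (admissible_theta12OfRecord F N _ _ _)

end Assembly

/-! ## §4. (v1.2) The rev-15 text of K0′ (`θ.SlotsNondegenerate` threaded next to `ZtUnity`, director LINES №108∕№109): the same assembly with row P12 (K0b's
`SlotsNondegenerate`, positive levels) as one more displayed HYPOTHESIS -/

section AssemblyRev15

variable {F N}

/-- **K0′'s rev-15 BODY for the family `F` (every `N`), MODULO ROWS (H-U), P6, P7, P11, P12**: `∃ θ, θ.Provisos₁₂ ∧ (θ.ZtUnity ∧ θ.SlotsNondegenerate) ∧ θ.Admissible` at any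
admissible Stage-12 parameter with K0b's residuals of record and the identity selector; `SlotsNondegenerate` (row P12) is a HYPOTHESIS here.  A REDUCTION — nothing is discharged.
[cite: Balaban1988Convergent, Thm 1 p.262; Balaban1989LargeFieldII, Thm 1 p.355 (bookkeeping)] -/
theorem Stage12Params.record12Inhabited_body15_of (θ : Stage12Params F N) (hsel : θ.ppSel = ppSelIdOfRecord F θ.ν θ.τ9.M)
    (hU : LocalBgMeasurable F N θ.ν) (hres : θ.HasResidualsOfRecord F N)
    (hrstep : ∀ (p : B12.RunParams) (k : ℕ) [DecidableEq (PBond (F.P p.K) (k + 1))], k < p.K →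
      (towerRepOfRecord F N θ.ν θ.τ9 (slotsTOfRecord F N θ.ν θ.τ9 (EOfRecord₁₀ F N θ.toStage9Params) (wOfRecord₉ F N θ.toStage9Params) θ.ppSel)
        θ.ppSel p (gOfRecord₁₀ F N θ.toStage9Params p) (k + 1)).toRepData.ProvisosSupp)
    (hcontT : θ.toStage8Params.HasContTransportAlong)
    (hbg : ∀ (p : B12.RunParams) (n : ℕ), n ≤ p.K → Step.InInterval θ.γ n (gOfRecord₁₀ F N θ.toStage9Params p) →
      BgProviso F N p.K (settingOfRecord₁₂ F N θ p) (θ.Rz p.K) θ.τ9.M n (suppOfRecord₁₂ F N θ p n) (UbgOfRecord₁₂ F N θ p n))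
    (hnd : θ.SlotsNondegenerate) (hadm : θ.Admissible F N) :
    ∃ θ' : Stage12Params F N, θ'.Provisos₁₂ F N ∧ (θ'.ZtUnity F N ∧ θ'.SlotsNondegenerate) ∧ θ'.Admissible F N :=
  ⟨θ, θ.provisos₁₂_of_localBg_of_residuals hsel hU hres hrstep hcontT hbg, ⟨hres.ztUnity, hnd⟩, hadm⟩

variable (F N) in
/-- **… AT THE θ OF RECORD** `θ₀ = theta12OfRecord F N (zeta316OfRecord F N numerics7OfRecord₁₂ 1 1) (RzOfRecord F N) (ZtOfRecord F N)`: K0′'s rev-15 body for `F` from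
`LocalBgMeasurable F N numerics7OfRecord₁₂` and the rows P6, P7, P11, P12 read AT `θ₀` (identity selector `rfl`, residuals `⟨rfl, rfl, rfl⟩`, K0a's `admissible_theta12OfRecord`).
[cite: Balaban1988Convergent, Thm 1 p.262 (bookkeeping)] -/
theorem record12Inhabited_body15_theta12OfRecord_of (hU : LocalBgMeasurable F N numerics7OfRecord₁₂)
    (hrstep : ∀ (p : B12.RunParams) (k : ℕ) [DecidableEq (PBond (F.P p.K) (k + 1))], k < p.K →
      (towerRepOfRecord F N numerics7OfRecord₁₂
          (theta12OfRecord F N (zeta316OfRecord F N numerics7OfRecord₁₂ 1 1) (RzOfRecord F N) (ZtOfRecord F N)).τ9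
          (slotsTOfRecord F N numerics7OfRecord₁₂
            (theta12OfRecord F N (zeta316OfRecord F N numerics7OfRecord₁₂ 1 1) (RzOfRecord F N) (ZtOfRecord F N)).τ9
            (EOfRecord₁₀ F N (theta12OfRecord F N (zeta316OfRecord F N numerics7OfRecord₁₂ 1 1) (RzOfRecord F N) (ZtOfRecord F N)).toStage9Params)
            (wOfRecord₉ F N (theta12OfRecord F N (zeta316OfRecord F N numerics7OfRecord₁₂ 1 1) (RzOfRecord F N) (ZtOfRecord F N)).toStage9Params)
            (ppSelIdOfRecord F numerics7OfRecord₁₂ 1))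
          (ppSelIdOfRecord F numerics7OfRecord₁₂ 1) p
          (gOfRecord₁₀ F N (theta12OfRecord F N (zeta316OfRecord F N numerics7OfRecord₁₂ 1 1) (RzOfRecord F N) (ZtOfRecord F N)).toStage9Params p)
          (k + 1)).toRepData.ProvisosSupp)
    (hcontT : (theta12OfRecord F N (zeta316OfRecord F N numerics7OfRecord₁₂ 1 1) (RzOfRecord F N) (ZtOfRecord F N)).toStage8Params.HasContTransportAlong)
    (hbg : ∀ (p : B12.RunParams) (n : ℕ), n ≤ p.K →
      Step.InInterval (1 / 2 : ℝ) n
        (gOfRecord₁₀ F N (theta12OfRecord F N (zeta316OfRecord F N numerics7OfRecord₁₂ 1 1) (RzOfRecord F N) (ZtOfRecord F N)).toStage9Params p) →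
      BgProviso F N p.K
        (settingOfRecord₁₂ F N (theta12OfRecord F N (zeta316OfRecord F N numerics7OfRecord₁₂ 1 1) (RzOfRecord F N) (ZtOfRecord F N)) p)
        (RzOfRecord F N p.K) 1 n
        (suppOfRecord₁₂ F N (theta12OfRecord F N (zeta316OfRecord F N numerics7OfRecord₁₂ 1 1) (RzOfRecord F N) (ZtOfRecord F N)) p n)
        (UbgOfRecord₁₂ F N (theta12OfRecord F N (zeta316OfRecord F N numerics7OfRecord₁₂ 1 1) (RzOfRecord F N) (ZtOfRecord F N)) p n))
    (hnd : (theta12OfRecord F N (zeta316OfRecord F N numerics7OfRecord₁₂ 1 1) (RzOfRecord F N) (ZtOfRecord F N)).SlotsNondegenerate) :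
    ∃ θ : Stage12Params F N, θ.Provisos₁₂ F N ∧ (θ.ZtUnity F N ∧ θ.SlotsNondegenerate) ∧ θ.Admissible F N :=
  (theta12OfRecord F N (zeta316OfRecord F N numerics7OfRecord₁₂ 1 1) (RzOfRecord F N) (ZtOfRecord F N)).record12Inhabited_body15_of
    rfl hU ⟨rfl, rfl, rfl⟩ hrstep hcontT hbg hnd (admissible_theta12OfRecord F N _ _ _)

end AssemblyRev15

end Literature.MathematicalPhysics.QuantumFieldTheory.Balaban1983to89.Node00

end
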